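import Mathlib
import Summits.BirchSwinnertonDyer.BirchSwinnertonDyer.Theorems.ManinLocalTwoThreeOddDegreeLValueDenominator
import Summits.BirchSwinnertonDyer.Rank1Residual.ManinAdditive.OddDegreeTooth
import Literature.NumberTheory.EllipticCurves.SkinnerUrban2014.PAdicUnitPeriodRatioAnyPrimeProofs
import Literature.NumberTheory.EllipticCurves.BSDQuadraticDescentPeriodEliminationProofs
import Literature.NumberTheory.EllipticCurves.BSDQuadraticDescent
import HarnessLib

/-!
# `N = 4p`, one real component, lattice-optimal: `6·L(E,1)/Ω⁺_f ∈ ℤ`, ODD when the degree is odd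

Summit `BirchSwinnertonDyer`, sub-problem `BirchSwinnertonDyer`, route `ManinLocalTwoThree`; width seat `bsd-line-manin23-p2`
(gen 9), `--supports` the crux C2 `ManinOddAtFour` (stmt-BirchSwinnertonDyer-22967).  Sharpening of
`ManinLocalTwoThreeOddDegreeLValueDenominator` (`12·[0]⁺_f ∈ ℤ`, `4 ∤` it for odd degree) when the curve has ONE real
component (`Δ_W < 0`, so `Λ_W ∩ ℝ = ℤ·Ω(W)`) and the datum is lattice-optimal (`Λ_W = c·Λ_f`, so
`Ω(W) = |c|·Ω⁺_f`): then `6·{∞,0}_f ∈ Λ_f ∩ ℝ` gives `6c·[0]⁺_f·Ω⁺_f ∈ ℤ·|c|·Ω⁺_f`, i.e. `6·[0]⁺_f ∈ ℤ`, and odd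
degree (`3·[0]⁺_f ∉ ℤ`) makes `6·[0]⁺_f` ODD: `[0]⁺_f = L(W,1)/Ω⁺_f = k/6`, `k` odd — the cusp "half-unit" of the an-lens (E-an-106♭
`BlindTameOddDegreeCuspHalf`) up to the SIGN of `L(W,1)`, for EVERY curve with `Δ < 0` at level `4p` (no family, no
congruence on `m`).  With the printed positivity `L(E,1) ≥ 0` (Guo 1996 / Lapid–Rallis 2003; tree named
fact `WeierstrassCurve.re_entireLFunction_one_nonneg`, taken BY NAME as a hypothesis) the `ℕ`-witness form
`2b·[0]⁺_f = a`, `a, b` odd, follows; specialised to the blind family `E′_m : y² = x³ − 2mx² + (m²+4)x` (`Δ = −256(m²+4)² < 0`) at level `4p` this is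
E-an-106♭'s conclusion for data at the family level `N = 4p` (the row itself quantifies over every level carrying a datum,
which needs Carayol's `N = N_E`; not claimed here).

PROVED here (no `sorry`): `minRealPeriod_eq_abs_mul_plusPeriod_of_Δ_neg`, **`exists_six_mul_ratPlusSymbol_zero_eq_of_Δ_neg`**,
**`six_mul_ratPlusSymbol_zero_odd_of_odd_deg`**, `ratPlusSymbol_zero_pos_of_nonneg` (conditional on the positivity fact),
**`cuspHalfUnit_of_odd_deg_of_nonneg`**, `blindCurve_Δ_neg`, **`blindCurve_cuspHalfUnit_of_odd_deg_of_nonneg`**.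
BSD is not proved by this; Manin's conjecture is not proved by this.
-/

set_option autoImplicit false
set_option linter.dupNamespace false

noncomputable section

open scoped MatrixGroups ModularForm
open CongruenceSubgroup
open Literature.NumberTheory.EllipticCurves Literature.NumberTheory.EllipticCurves.ModularForms
open Summit.BirchSwinnertonDyer.Rank1Residual.ManinAdditive.ShimuraLedger
open Summit.BirchSwinnertonDyer.Rank1Residual.ManinAdditive.OddDegreeTooth

namespace Summit.BirchSwinnertonDyer.BirchSwinnertonDyer.Theorems.ManinLocalTwoThree

/-- **`Ω₀(Λ_W) = |c|·Ω⁺_f`** for a lattice-optimal datum of a curve with one real component (`Δ_W < 0`):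
`Ω(W) = #π₀·Ω₀ = Ω₀` and `Ω(W) = |c|·Ω⁺_f`. -/
theorem minRealPeriod_eq_abs_mul_plusPeriod_of_Δ_neg {W : WeierstrassCurve ℚ} [W.IsElliptic] {N : ℕ} [NeZero N]
    (D : ModularParametrizationData W N) (hΔ : W.Δ < 0)
    (hopt : ∀ z ∈ D.L.lattice, ∃ w ∈ periodLattice D.f, z = D.c * w) :
    D.L.minRealPeriod = |(D.c : ℝ)| * plusPeriod D.f := by
  have hν : (W.baseChange ℝ).numRealComponents = 1 := by
    rw [WeierstrassCurve.numRealComponents_baseChange_real, if_neg (not_lt.mpr hΔ.le)]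
  have h1 := D.realPeriodRat_eq_numRealComponents_mul
  rw [hν, Nat.cast_one, one_mul] at h1
  rw [← h1, D.realPeriodRat_eq_abs_mul_plusPeriod_of_latticeEq hopt]

/-- **`6·L(W,1)/Ω⁺_f ∈ ℤ`** at `N = 4p` for a lattice-optimal datum of a curve with `Δ_W < 0` (every such curve, any degree):
`6·{∞,0}_f ∈ Λ_f` is real, so `6c·{∞,0}_f ∈ Λ_W ∩ ℝ = ℤ·Ω₀ = ℤ·|c|·Ω⁺_f`. -/
theorem exists_six_mul_ratPlusSymbol_zero_eq_of_Δ_neg {W : WeierstrassCurve ℚ} [W.IsElliptic] {p : ℕ} [NeZero (4 * p)]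
    (hp : p.Prime) (hp2 : p ≠ 2) (D : ModularParametrizationData W (4 * p)) (hΔ : W.Δ < 0)
    (hopt : ∀ z ∈ D.L.lattice, ∃ w ∈ periodLattice D.f, z = D.c * w) :
    ∃ k : ℤ, 6 * ratPlusSymbol D.f 0 = k := by
  have hΩ : 0 < plusPeriod D.f :=
    IsNewform0.plusPeriod_pos_holds D.isNewformOf.1 D.isNewformOf.coeffField_eq_bot
  have h6 : (((6 * (((ratPlusSymbol D.f 0 : ℚ) : ℝ) * plusPeriod D.f) : ℝ)) : ℂ) ∈ periodLattice D.f := by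
    convert six_mul_cuspZeroSymbol_mem hp hp2 D using 1
    rw [modularSymbol_zero_eq_ratPlusSymbol_mul_plusPeriod D]
    push_cast
    ring
  have hc6 : ((((D.c : ℝ) * (6 * (((ratPlusSymbol D.f 0 : ℚ) : ℝ) * plusPeriod D.f)) : ℝ)) : ℂ) ∈ D.L.lattice := by
    have := D.smul_periodLattice_le _ h6
    push_cast at this ⊢
    exact this
  obtain ⟨k, hk⟩ := D.isReal_neronLattice.exists_eq_int_mul hc6
  rw [minRealPeriod_eq_abs_mul_plusPeriod_of_Δ_neg D hΔ hopt] at hk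
  have hc : (D.c : ℝ) ≠ 0 := Int.cast_ne_zero.mpr D.maninConstant_ne_zero_holds
  have e1 : ((D.c : ℝ) * (6 * ((ratPlusSymbol D.f 0 : ℚ) : ℝ))) * plusPeriod D.f =
      ((k : ℝ) * |(D.c : ℝ)|) * plusPeriod D.f := by
    linear_combination hk
  have e2 : (D.c : ℝ) * (6 * ((ratPlusSymbol D.f 0 : ℚ) : ℝ)) = (k : ℝ) * |(D.c : ℝ)| :=
    mul_right_cancel₀ hΩ.ne' e1
  rcases lt_or_gt_of_ne hc with hneg | hpos
  · refine ⟨-k, ?_⟩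
    rw [abs_of_neg hneg] at e2
    have e3 : (D.c : ℝ) * (6 * ((ratPlusSymbol D.f 0 : ℚ) : ℝ)) = (D.c : ℝ) * (-(k : ℝ)) := by rw [e2]; ring
    have e4 : 6 * ((ratPlusSymbol D.f 0 : ℚ) : ℝ) = -(k : ℝ) := mul_left_cancel₀ hc e3
    exact_mod_cast e4
  · refine ⟨k, ?_⟩
    rw [abs_of_pos hpos] at e2
    have e3 : (D.c : ℝ) * (6 * ((ratPlusSymbol D.f 0 : ℚ) : ℝ)) = (D.c : ℝ) * (k : ℝ) := by rw [e2]; ring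
    have e4 : 6 * ((ratPlusSymbol D.f 0 : ℚ) : ℝ) = (k : ℝ) := mul_left_cancel₀ hc e3
    exact_mod_cast e4

/-- **Odd degree at `N = 4p`, `Δ_W < 0`, lattice-optimal ⟹ `6·L(W,1)/Ω⁺_f` is an ODD integer** (every such curve). -/
theorem six_mul_ratPlusSymbol_zero_odd_of_odd_deg {W : WeierstrassCurve ℚ} [W.IsElliptic] {p : ℕ} [NeZero (4 * p)]
    (hp : p.Prime) (hp2 : p ≠ 2) (D : ModularParametrizationData W (4 * p)) (hΔ : W.Δ < 0)
    (hopt : ∀ z ∈ D.L.lattice, ∃ w ∈ periodLattice D.f, z = D.c * w) (hodd : Odd D.deg) :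
    ∃ k : ℤ, Odd k ∧ 6 * ratPlusSymbol D.f 0 = k := by
  obtain ⟨k, hk⟩ := exists_six_mul_ratPlusSymbol_zero_eq_of_Δ_neg hp hp2 D hΔ hopt
  refine ⟨k, ?_, hk⟩
  rw [← Int.not_even_iff_odd]
  rintro ⟨j, rfl⟩
  exact not_exists_three_mul_ratPlusSymbol_zero_eq_int_of_odd_deg hp hp2 D hodd ⟨j, by push_cast at hk; linarith⟩

/-- `[0]⁺_f > 0` from `L(W,1) ≥ 0` (the printed positivity, BY NAME) and `L(W,1) ≠ 0` (odd degree at `4p`). -/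
theorem ratPlusSymbol_zero_pos_of_nonneg (hPOS : WeierstrassCurve.re_entireLFunction_one_nonneg)
    {W : WeierstrassCurve ℚ} [W.IsElliptic] {p : ℕ} [NeZero (4 * p)]
    (hp : p.Prime) (hp2 : p ≠ 2) (D : ModularParametrizationData W (4 * p)) (hodd : Odd D.deg) :
    0 < ratPlusSymbol D.f 0 := by
  have hΩ : 0 < plusPeriod D.f := IsNewform0.plusPeriod_pos_holds D.isNewformOf.1 D.isNewformOf.coeffField_eq_bot
  have hre : (W.entireLFunction 1).re = ((ratPlusSymbol D.f 0 : ℚ) : ℝ) * plusPeriod D.f := by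
    rw [D.isNewformOf.entireLFunction_one_eq, Complex.ofReal_re]
  have hne : W.entireLFunction 1 ≠ 0 := by
    rw [← D.isNewformOf.modularSymbol_zero_eq_entireLFunction_one]
    exact modularSymbol_zero_ne_zero_of_odd_deg hp hp2 D hodd
  have hre_ne : (W.entireLFunction 1).re ≠ 0 := by
    intro h0
    apply hne
    apply Complex.ext
    · rw [h0, Complex.zero_re]
    · rw [D.isNewformOf.entireLFunction_one_eq, Complex.ofReal_im, Complex.zero_im]
  have hpos : 0 < (W.entireLFunction 1).re := lt_of_le_of_ne (hPOS W) (Ne.symm hre_ne)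
  rw [hre] at hpos
  exact_mod_cast (pos_iff_pos_of_mul_pos hpos).mpr hΩ

/-- **The cusp half-unit, conditional on `L(E,1) ≥ 0`:** at `N = 4p`, for a lattice-optimal odd-degree datum of ANY curve
with `Δ_W < 0`, `2b·[0]⁺_f = a` with `a, b ∈ ℕ` odd (`b = 3`). -/
theorem cuspHalfUnit_of_odd_deg_of_nonneg (hPOS : WeierstrassCurve.re_entireLFunction_one_nonneg)
    {W : WeierstrassCurve ℚ} [W.IsElliptic] {p : ℕ} [NeZero (4 * p)]
    (hp : p.Prime) (hp2 : p ≠ 2) (D : ModularParametrizationData W (4 * p)) (hΔ : W.Δ < 0)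
    (hopt : ∀ z ∈ D.L.lattice, ∃ w ∈ periodLattice D.f, z = D.c * w) (hodd : Odd D.deg) :
    ∃ a b : ℕ, ¬ 2 ∣ a ∧ ¬ 2 ∣ b ∧ 2 * (b : ℚ) * ratPlusSymbol D.f 0 = a := by
  obtain ⟨k, hk, hk6⟩ := six_mul_ratPlusSymbol_zero_odd_of_odd_deg hp hp2 D hΔ hopt hodd
  have hkpos : 0 < k := by
    have h6 : (0 : ℚ) < 6 * ratPlusSymbol D.f 0 := by
      have := ratPlusSymbol_zero_pos_of_nonneg hPOS hp hp2 D hodd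
      positivity
    rw [hk6] at h6
    exact_mod_cast h6
  refine ⟨k.toNat, 3, ?_, by decide, ?_⟩
  · intro h2
    have : (2 : ℤ) ∣ k := by
      have h' : ((k.toNat : ℕ) : ℤ) = k := Int.toNat_of_nonneg hkpos.le
      rw [← h']
      exact_mod_cast h2
    exact (Int.not_even_iff_odd.mpr hk) (even_iff_two_dvd.mpr this)
  · have h' : ((k.toNat : ℕ) : ℚ) = (k : ℚ) := by exact_mod_cast Int.toNat_of_nonneg hkpos.le
    rw [h', ← hk6]
    push_cast
    ring

/-- `Δ(E′_m) = −256·(m²+4)² < 0`: the blind family has one real component. -/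
theorem blindCurve_Δ_neg (m : ℤ) : (blindCurve m).Δ < 0 := by
  rw [blindCurve_Δ]
  have : (0 : ℚ) < ((m : ℚ) ^ 2 + 4) ^ 2 := by positivity
  linarith

/-- **E-an-106♭'s conclusion at the family level `N = 4p`, for EVERY `m` (conditional only on `L(E,1) ≥ 0` BY NAME):**
an odd-degree lattice-optimal `X₀(4p)`-datum of `E′_m` has `2b·[0]⁺_f = a` with `a, b` odd. -/
theorem blindCurve_cuspHalfUnit_of_odd_deg_of_nonneg (hPOS : WeierstrassCurve.re_entireLFunction_one_nonneg)
    (m : ℤ) {p : ℕ} [NeZero (4 * p)] (hp : p.Prime) (hp2 : p ≠ 2)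
    (D : ModularParametrizationData (blindCurve m) (4 * p))
    (hopt : ∀ z ∈ D.L.lattice, ∃ w ∈ periodLattice D.f, z = D.c * w) (hodd : Odd D.deg) :
    ∃ a b : ℕ, ¬ 2 ∣ a ∧ ¬ 2 ∣ b ∧ 2 * (b : ℚ) * ratPlusSymbol D.f 0 = a := by
  haveI := isElliptic_blindCurve m
  exact cuspHalfUnit_of_odd_deg_of_nonneg hPOS hp hp2 D (blindCurve_Δ_neg m) hopt hodd

end Summit.BirchSwinnertonDyer.BirchSwinnertonDyer.Theorems.ManinLocalTwoThree

end
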